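import Literature.AlgebraicTopology.SingularHomology.BoundaryTransfer
import Literature.AlgebraicTopology.SingularHomology.LocalHomologyMayerVietorisCriteria
import Mathlib.Analysis.Convex.Contractible
import HarnessLib

/-!
# The interior of a compact-boundary manifold carries all of its homology:
# `Hₖ(X, X ∖ ∂X) = 0`

Topic `Literature/AlgebraicTopology/SingularHomology`; written for the fact seat
`provefact-Literature.Topology.FourManifolds.sliceGenus_torusKnot` (the genus of the closed Milnor
fibre of a torus knot is read off from its interior, the affine Milnor fibre).  Everything here is
**proved**; no named fact is introduced.

For a `C¹` manifold with boundary `X` (Hausdorff, charts in `EuclideanHalfSpace (n+1)`) whose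
boundary `∂X` is compact, the local homology of `X` along its boundary vanishes,
`Hₖ(X | ∂X; M) = Hₖ(X, X ∖ ∂X; M) = 0` for all `k` (`isZero_localHomologyOfSet_boundary`), so that
by the long exact sequence of the pair the inclusion of the interior `X ∖ ∂X ↪ X` induces
isomorphisms on singular homology in all degrees (`isIso_singularHomology_map_interior`) — the
homological shadow of the collar theorem (A. Hatcher, *Algebraic Topology* (2002), Prop. 3.42:
a compact manifold with boundary has a collar neighbourhood `∂X × [0, 1)`, so `X ∖ ∂X ↪ X` is a
homotopy equivalence), obtained here without collars by the local-to-global pattern of Hatcher's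
Lemma 3.27 (§3.3, p. 236):

* **locally** (`HalfChart.isZero_localHomologyOfSet`): in a half chart `e : U → [0, 4h) × ball`
  at a boundary point (the tree's `HalfChart`, `BoundaryTransfer.lean`), for a closed `Z ⊆ ∂X`
  inside the chart box, excision gives `Hₖ(X | Z) ≅ Hₖ(box | Z)` (`localHomologyOfSet.openSubsetIso`)
  and both the box and `box ∖ Z` are contractible — the latter is star-shaped about the centre
  `(2h, 0)` of the box, since a segment from a point of positive height only reaches the face
  `{height = 0} ⊇ e(Z)` at its endpoint — so `Hₖ(box | Z) = 0`
  (`isZero_localHomologyOfSet_of_contractibleSpace`);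
* **finite unions** (`isZero_localHomologyOfSet_biUnion`): the relative Mayer–Vietoris sequence
  `Hₖ₊₁(X | A ∩ B) → Hₖ(X | A ∪ B) → Hₖ(X | A) ⊕ Hₖ(X | B)` (Hatcher §2.2 p. 152; the tree's
  `localHomologyOfSet.isZero_localHomologyOfSet_union`) and induction on the number of pieces,
  for the hereditary class of closed sets all of whose closed subsets have vanishing local
  homology;
* **globally**: the compact `∂X` is a finite union of closed pieces of `∂X` inside chart boxes
  (`SmoothHalfChart.exists_halfChart`).

## Main results

* `Literature.AlgebraicTopology.SingularHomology.HalfChart.isZero_localHomologyOfSet`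
* `Literature.AlgebraicTopology.SingularHomology.isZero_localHomologyOfSet_biUnion`
* `Literature.AlgebraicTopology.SingularHomology.isZero_localHomologyOfSet_boundary`
* `Literature.AlgebraicTopology.SingularHomology.isIso_singularHomology_map_interior`

## References

* A. Hatcher, *Algebraic Topology*, CUP 2002, §2.1 Thm. 2.13–2.16, Thm. 2.20; §2.2 p. 152;
  §3.3 Lemma 3.27 (p. 236), p. 252; Prop. 3.42 (collars). [HatcherAT2002]
-/

noncomputable section

open CategoryTheory Limits Set Function Topology Metric
open scoped Manifold ContDiff

universe u v

namespace Literature.AlgebraicTopology.SingularHomology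

variable (R : Type v) [CommRing R] (M : Type v) [AddCommGroup M] [Module R M]

/-! ### Locally: closed pieces of the boundary inside a half-chart box -/

namespace HalfChart

variable {X : Type u} [TopologicalSpace X] {B : Set X} {p : X} {F : Type} [NormedAddCommGroup F]
  [NormedSpace ℝ F] {h : ℝ} (c : HalfChart B p F h)

/-- The model of `box ∖ Z` in the chart: the points of the open half-box whose preimage avoids
`Z`. [folklore] -/
def boxDiffModel (Z : Set X) : Set (ℝ × F) := {v | v ∈ HalfBall.halfBox (4 * h) ∧ c.e.symm v ∉ Z}

/-- The centre `(2h, 0)` of the box lies in the model piece when `Z ⊆ B`. [folklore] -/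
theorem center_mem_boxDiffModel {Z : Set X} (hZB : Z ⊆ B) : ((2 * h, 0) : ℝ × F) ∈ c.boxDiffModel Z := by
  have hpos := c.pos
  have hmem : ((2 * h, 0) : ℝ × F) ∈ HalfBall.halfBox (4 * h) :=
    HalfBall.mem_halfBox.2 ⟨by positivity, by linarith, by simpa using (by linarith : (0 : ℝ) < 4 * h)⟩
  refine ⟨hmem, fun hZ => ?_⟩
  have hvt : ((2 * h, 0) : ℝ × F) ∈ c.e.target :=
    c.subset_target ⟨hmem.1, ball_subset_closedBall hmem.2⟩
  have h0 := (c.mem_iff (c.e.symm (2 * h, 0)) (c.e.map_target hvt)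
    (by rw [c.e.right_inv hvt]; exact ball_subset_closedBall hmem.2)).1 (hZB hZ)
  rw [c.e.right_inv hvt] at h0
  have : (2 : ℝ) * h = 0 := h0
  linarith

/-- **`box ∖ Z` is star-shaped in the chart** about the centre `(2h, 0)`, for `Z ⊆ B`: a point of
the segment from the centre to `v` has positive height except at the endpoint `v`, while `e(Z)`
lies on the face `{height = 0}`. [folklore] -/
theorem starConvex_boxDiffModel {Z : Set X} (hZB : Z ⊆ B) :
    StarConvex ℝ ((2 * h, 0) : ℝ × F) (c.boxDiffModel Z) := by
  have hpos := c.pos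
  intro v hv a b ha hb hab
  have hconv := HalfBall.convex_halfBox (F := F) (4 * h)
  have hmem : a • ((2 * h, 0) : ℝ × F) + b • v ∈ HalfBall.halfBox (4 * h) :=
    hconv (c.center_mem_boxDiffModel hZB).1 hv.1 ha hb hab
  refine ⟨hmem, fun hZ => ?_⟩
  have hvt : a • ((2 * h, 0) : ℝ × F) + b • v ∈ c.e.target :=
    c.subset_target ⟨hmem.1, ball_subset_closedBall hmem.2⟩
  have h0 := (c.mem_iff (c.e.symm (a • ((2 * h, 0) : ℝ × F) + b • v)) (c.e.map_target hvt)
    (by rw [c.e.right_inv hvt]; exact ball_subset_closedBall hmem.2)).1 (hZB hZ)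
  rw [c.e.right_inv hvt] at h0
  have h0' : a * (2 * h) + b * v.1 = 0 := by simpa using h0
  have hv1 : 0 ≤ v.1 := (HalfBall.mem_halfBox.1 hv.1).1
  -- `a = 0`, so the point is `v` itself
  have ha0 : a = 0 := by nlinarith [mul_nonneg hb hv1]
  have hb1 : b = 1 := by linarith
  subst ha0 hb1
  apply hv.2
  simpa using hZ

/-- The model piece is contractible (star-shaped and nonempty). [folklore] -/
theorem contractibleSpace_boxDiffModel {Z : Set X} (hZB : Z ⊆ B) : ContractibleSpace ↥(c.boxDiffModel Z) :=
  (c.starConvex_boxDiffModel hZB).contractibleSpace ⟨_, c.center_mem_boxDiffModel hZB⟩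

/-- **`box ∖ Z ≅` the model piece** (restriction of the chart). [folklore] -/
def boxDiffHomeomorph (Z : Set X) : ↥(c.box ∩ Zᶜ) ≃ₜ ↥(c.boxDiffModel Z) :=
  c.e.homeomorphOfMapsTo c.continuousOn c.continuousOn_symm
    (inter_subset_left.trans inter_subset_left)
    (fun v hv => c.subset_target ⟨hv.1.1, ball_subset_closedBall hv.1.2⟩)
    (fun x hx => ⟨⟨c.nonneg_fst hx.1.1, hx.1.2⟩, by
      rw [c.e.left_inv hx.1.1]; exact hx.2⟩)
    (fun v hv => by
      have hvt : v ∈ c.e.target := c.subset_target ⟨hv.1.1, ball_subset_closedBall hv.1.2⟩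
      exact ⟨⟨c.e.map_target hvt, by rw [mem_preimage, c.e.right_inv hvt]; exact hv.1.2⟩, hv.2⟩)

/-- The complement of `Z` within the box, as a subspace of the box, is `box ∖ Z`. [folklore] -/
def boxComplHomeomorph (Z : Set X) :
    ↥((Subtype.val ⁻¹' Z)ᶜ : Set ↥c.box) ≃ₜ ↥(c.box ∩ Zᶜ) where
  toFun x := ⟨x.1.1, x.1.2, x.2⟩
  invFun x := ⟨⟨x.1, x.2.1⟩, x.2.2⟩
  left_inv _ := rfl
  right_inv _ := rfl
  continuous_toFun := (continuous_subtype_val.comp continuous_subtype_val).subtype_mk _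
  continuous_invFun := (continuous_subtype_val.subtype_mk _).subtype_mk _

/-- **Local vanishing**: for a closed `Z ⊆ B` inside the box of a half chart (`X` Hausdorff),
`Hₖ(X | Z; M) = 0` for all `k` — excise to the contractible box (`openSubsetIso`), whose
complement of `Z` is contractible (`contractibleSpace_boxDiffModel`); Hatcher (2002), Thm. 2.20
and §2.1. [cite: HatcherAT2002, Thm. 2.20 and §2.1 Thm. 2.16] -/
theorem isZero_localHomologyOfSet [T2Space X] {Z : Set X} (hZB : Z ⊆ B) (hZc : IsClosed Z)
    (hZbox : Z ⊆ c.box) (k : ℕ) : IsZero (localHomologyOfSet R M X Z k) := by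
  have hcontr : ContractibleSpace ↥((Subtype.val ⁻¹' Z)ᶜ : Set ↥c.box) :=
    haveI := c.contractibleSpace_boxDiffModel hZB
    ((c.boxComplHomeomorph Z).trans (c.boxDiffHomeomorph Z)).contractibleSpace
  have hloc : IsZero (localHomologyOfSet R M (↥c.box) (Subtype.val ⁻¹' Z) k) :=
    @isZero_localHomologyOfSet_of_contractibleSpace R _ M _ _ (↥c.box) _ _ (Subtype.val ⁻¹' Z) hcontr k
  exact hloc.of_iso (localHomologyOfSet.openSubsetIso R M c.isOpen_box
    (by rw [hZc.closure_eq]; exact hZbox) k).symm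

end HalfChart

/-! ### Finite unions: the relative Mayer–Vietoris induction -/

section Unions

variable {X : Type u} [TopologicalSpace X]

/-- The hereditary vanishing class: closed sets all of whose closed subsets have vanishing local
homology in every degree. [folklore] -/
def IsLocallyAcyclicSet (Z : Set X) : Prop :=
  IsClosed Z ∧ ∀ Z' : Set X, Z' ⊆ Z → IsClosed Z' → ∀ k, IsZero (localHomologyOfSet R M X Z' k)

/-- Closed subsets of members are members. [folklore] -/
theorem IsLocallyAcyclicSet.subset {Z Z' : Set X} (hZ : IsLocallyAcyclicSet R M Z) (h : Z' ⊆ Z)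
    (hc : IsClosed Z') : IsLocallyAcyclicSet R M Z' :=
  ⟨hc, fun Z'' h'' hc'' k => hZ.2 Z'' (h''.trans h) hc'' k⟩

/-- Members have vanishing local homology. [folklore] -/
theorem IsLocallyAcyclicSet.isZero {Z : Set X} (hZ : IsLocallyAcyclicSet R M Z) (k : ℕ) :
    IsZero (localHomologyOfSet R M X Z k) :=
  hZ.2 Z subset_rfl hZ.1 k

/-- `Hₖ(X | ∅) = Hₖ(X, X) = 0`. [folklore] -/
theorem isZero_localHomologyOfSet_empty (k : ℕ) : IsZero (localHomologyOfSet R M X (∅ : Set X) k) := by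
  change IsZero (relativeSingularHomology R M X (∅ : Set X)ᶜ k)
  rw [Set.compl_empty]
  exact isZero_relativeSingularHomology_univ R M k

/-- **Vanishing along finite unions** (Hatcher 2002, §2.2 p. 152 / proof of Lemma 3.27 (b)): a
finite union of sets of the hereditary vanishing class has vanishing local homology, by induction
on the number of pieces with the relative Mayer–Vietoris sequence
(`localHomologyOfSet.isZero_localHomologyOfSet_union`): `Z₀ ∩ ⋃ᵢ Zᵢ = ⋃ᵢ (Z₀ ∩ Zᵢ)` is again
such a union. [cite: HatcherAT2002, §2.2 p. 152] -/
theorem isZero_localHomologyOfSet_biUnion {ι : Type*} (S : Finset ι) :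
    ∀ (Z : ι → Set X), (∀ i ∈ S, IsLocallyAcyclicSet R M (Z i)) →
      ∀ k, IsZero (localHomologyOfSet R M X (⋃ i ∈ S, Z i) k) := by
  classical
  induction S using Finset.induction_on with
  | empty =>
    intro Z _ k
    rw [show (⋃ i ∈ (∅ : Finset ι), Z i) = ∅ by simp]
    exact isZero_localHomologyOfSet_empty R M k
  | insert a S ha ih =>
    intro Z hZ k
    rw [Finset.set_biUnion_insert]
    have hZa : IsLocallyAcyclicSet R M (Z a) := hZ a (Finset.mem_insert_self a S)
    have hZS : ∀ i ∈ S, IsLocallyAcyclicSet R M (Z i) := fun i hi => hZ i (Finset.mem_insert_of_mem hi)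
    have hclosed : IsClosed (⋃ i ∈ S, Z i) := isClosed_biUnion_finset fun i hi => (hZS i hi).1
    have hinter : ∀ j, IsZero (localHomologyOfSet R M X (Z a ∩ ⋃ i ∈ S, Z i) j) := by
      intro j
      rw [Set.inter_iUnion₂]
      exact ih (fun i => Z a ∩ Z i)
        (fun i hi => (hZS i hi).subset R M inter_subset_right ((hZa.1).inter (hZS i hi).1)) j
    refine localHomologyOfSet.isZero_localHomologyOfSet_union R M hZa.1 hclosed k (hZa.isZero R M k)
      (ih Z hZS k) ?_
    haveI := ModuleCat.subsingleton_of_isZero (hinter (k + 1))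
    intro y
    exact ⟨0, Subsingleton.elim _ _⟩

end Unions

/-! ### Globally: the boundary of a compact-boundary `C¹` manifold -/

section Boundary

variable {n : ℕ} {X : Type u} [TopologicalSpace X] [T2Space X]
  [ChartedSpace (EuclideanHalfSpace (n + 1)) X] {m : WithTop ℕ∞} [IsManifold (𝓡∂ (n + 1)) m X]

/-- **A closed piece of the boundary inside a half-chart box is in the hereditary vanishing
class.** [cite: HatcherAT2002, Thm. 2.20 and §2.1 Thm. 2.16] -/
theorem HalfChart.isLocallyAcyclicSet_of_subset {p : X} {h : ℝ}
    (c : HalfChart ((𝓡∂ (n + 1)).boundary X) p (EuclideanSpace ℝ (Fin n)) h) {Z : Set X}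
    (hZB : Z ⊆ (𝓡∂ (n + 1)).boundary X) (hZc : IsClosed Z) (hZbox : Z ⊆ c.box) :
    IsLocallyAcyclicSet R M Z :=
  ⟨hZc, fun _ h' hc' k => c.isZero_localHomologyOfSet R M (h'.trans hZB) hc' (h'.trans hZbox) k⟩

/-- **The local homology of a `C¹` manifold with boundary along its compact boundary vanishes**:
`Hₖ(X, X ∖ ∂X; M) = 0` for all `k` (the homological content of the collar theorem, Hatcher 2002,
Prop. 3.42, obtained by the local-to-global argument of Lemma 3.27: the boundary is a finite
union of closed pieces inside half-chart boxes, each in the hereditary vanishing class).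
[cite: HatcherAT2002, §3.3 Lemma 3.27 and Prop. 3.42] -/
theorem isZero_localHomologyOfSet_boundary (hm : m ≠ 0)
    (hB : IsCompact ((𝓡∂ (n + 1)).boundary X)) (k : ℕ) :
    IsZero (localHomologyOfSet R M X ((𝓡∂ (n + 1)).boundary X) k) := by
  set B : Set X := (𝓡∂ (n + 1)).boundary X with hBdef
  have hBc : IsClosed B := (𝓡∂ (n + 1)).isClosed_boundary (M := X) hm
  -- half charts at the boundary points
  have hch : ∀ x ∈ B, ∃ h : ℝ, Nonempty (HalfChart B x (EuclideanSpace ℝ (Fin n)) h) :=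
    fun x hx => SmoothHalfChart.exists_halfChart n hm hx
  choose hh cc using hch
  -- the open neighbourhoods `e⁻¹ (ball 0 (2h))` and the closed pieces `B ∩ e⁻¹ (closedBall 0 (2h))`
  let c : ∀ x (hx : x ∈ B), HalfChart B x (EuclideanSpace ℝ (Fin n)) (hh x hx) :=
    fun x hx => (cc x hx).some
  let O : ∀ x ∈ B, Set X := fun x hx => (c x hx).e.source ∩ (c x hx).e ⁻¹' ball 0 (2 * hh x hx)
  let W : ∀ x ∈ B, Set X := fun x hx =>
    B ∩ ((c x hx).e.source ∩ (c x hx).e ⁻¹' closedBall 0 (2 * hh x hx))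
  have hO : ∀ x (hx : x ∈ B), O x hx ∈ nhds x := by
    intro x hx
    have hpos := (c x hx).pos
    refine ((c x hx).continuousOn.isOpen_inter_preimage (c x hx).isOpen_source isOpen_ball).mem_nhds
      ⟨(c x hx).mem_source, ?_⟩
    rw [mem_preimage, (c x hx).apply_eq_zero, mem_ball, dist_self]
    positivity
  have hWclosed : ∀ x (hx : x ∈ B), IsClosed (W x hx) := by
    intro x hx
    have hpos := (c x hx).pos
    have hsub : {v : ℝ × EuclideanSpace ℝ (Fin n) | 0 ≤ v.1} ∩ closedBall 0 (2 * hh x hx) ⊆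
        (c x hx).e.target := fun v hv =>
      (c x hx).subset_target ⟨hv.1, closedBall_subset_closedBall (by linarith) hv.2⟩
    have heq : (c x hx).e.source ∩ (c x hx).e ⁻¹' closedBall 0 (2 * hh x hx) =
        (c x hx).e.symm '' ({v : ℝ × EuclideanSpace ℝ (Fin n) | 0 ≤ v.1} ∩ closedBall 0 (2 * hh x hx)) := by
      rw [(c x hx).e.symm_image_eq_source_inter_preimage hsub]
      ext y
      constructor
      · rintro ⟨hy, hy'⟩
        exact ⟨hy, (c x hx).nonneg_fst hy, hy'⟩
      · rintro ⟨hy, -, hy'⟩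
        exact ⟨hy, hy'⟩
    refine hBc.inter ?_
    rw [heq]
    exact (((isCompact_closedBall _ _).inter_left (isClosed_le continuous_const continuous_fst)).image_of_continuousOn
      ((c x hx).continuousOn_symm.mono hsub)).isClosed
  have hWbox : ∀ x (hx : x ∈ B), W x hx ⊆ (c x hx).box := by
    intro x hx y hy
    have hpos := (c x hx).pos
    exact ⟨hy.2.1, mem_ball.2 (lt_of_le_of_lt (mem_closedBall.1 hy.2.2) (by linarith))⟩
  have hOW : ∀ x (hx : x ∈ B), B ∩ O x hx ⊆ W x hx := fun x hx y hy =>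
    ⟨hy.1, hy.2.1, ball_subset_closedBall hy.2.2⟩
  -- a finite subcover of the compact boundary
  obtain ⟨t, ht⟩ := hB.elim_nhds_subcover' O hO
  have hcover : B = ⋃ x ∈ t, W (x : X) x.2 := by
    apply Subset.antisymm
    · intro y hy
      obtain ⟨x, hxt, hyO⟩ := mem_iUnion₂.1 (ht hy)
      exact mem_iUnion₂.2 ⟨x, hxt, hOW x x.2 ⟨hy, hyO⟩⟩
    · exact iUnion₂_subset fun x _ => inter_subset_left
  rw [hcover]
  exact isZero_localHomologyOfSet_biUnion R M t (fun x => W (x : X) x.2)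
    (fun x _ => (c x x.2).isLocallyAcyclicSet_of_subset R M inter_subset_left (hWclosed x x.2)
      (hWbox x x.2)) k

/-- **The interior of a compact-boundary `C¹` manifold carries all of its homology**: the
inclusion `X ∖ ∂X ↪ X` induces isomorphisms `Hₖ(X ∖ ∂X; M) ≅ Hₖ(X; M)` for all `k` (long exact
sequence of the pair `(X, X ∖ ∂X)` with `H⁎(X, X ∖ ∂X) = 0`; Hatcher 2002, Thm. 2.16 and
Prop. 3.42). [cite: HatcherAT2002, Prop. 3.42] -/
theorem isIso_singularHomology_map_interior (hm : m ≠ 0)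
    (hB : IsCompact ((𝓡∂ (n + 1)).boundary X)) (k : ℕ) :
    IsIso (singularHomology.map R M (subsetIncl (((𝓡∂ (n + 1)).boundary X)ᶜ)) k) := by
  set A : Set X := ((𝓡∂ (n + 1)).boundary X)ᶜ with hA
  have hz : ∀ j, IsZero (relativeSingularHomology R M X A j) := fun j =>
    isZero_localHomologyOfSet_boundary R M hm hB j
  have hmono : Mono (singularHomology.map R M (subsetIncl A) k) :=
    (relativeSingularHomology.exact_δ_map R M (X := X) A k).mono_g ((hz (k + 1)).eq_of_src _ _)
  have hepi : Epi (singularHomology.map R M (subsetIncl A) k) :=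
    (relativeSingularHomology.exact_map_ofAbsolute R M (X := X) A k).epi_f ((hz k).eq_of_tgt _ _)
  exact isIso_of_mono_of_epi _

/-- The same for a compact manifold with boundary. [cite: HatcherAT2002, Prop. 3.42] -/
theorem isIso_singularHomology_map_interior_of_compactSpace [CompactSpace X] (hm : m ≠ 0) (k : ℕ) :
    IsIso (singularHomology.map R M (subsetIncl (((𝓡∂ (n + 1)).boundary X)ᶜ)) k) :=
  isIso_singularHomology_map_interior R M hm (((𝓡∂ (n + 1)).isClosed_boundary (M := X) hm).isCompact) k

end Boundary

end Literature.AlgebraicTopology.SingularHomology
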